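import Literature.NumberTheory.EllipticCurves.PAdicOneVariableNormCoherentUnitComapEquivariantTwo
import Literature.NumberTheory.EllipticCurves.PAdicDistributionAdditivity
import Literature.NumberTheory.EllipticCurves.ProfiniteGroupDistributionInduction
import Literature.NumberTheory.EllipticCurves.PAdicOneVariableSocketUnramifiedReading
import Literature.NumberTheory.GaloisRepresentations.LubinTateColemanUnitsLogDeriv
import HarnessLib

/-!
# `p = 2`: the family `β ↦ D_β = comap ν_β♭ ψ` of pulled-back log-free measures of the norm-coherent
# units is ADDITIVE, bounded and `U_0`-equivariant — de Shalit's I.3.4 Corollary: `i : 𝒰 → Λ(𝒢)`,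
# `i(β) = μ_β`, is a homomorphism of `ℤ_p⟦𝒢⟧`-modules (here through `GroupDistribution.induce`)

Topic `NumberTheory/EllipticCurves`; namespace `Literature.NumberTheory.EllipticCurves`.

De Shalit, *Iwasawa theory of elliptic curves with complex multiplication* (1987), I.3.4 Lemma (i)
"`μ_{ββ'} = μ_β + μ_{β'}`", (ii) and the Corollary (p. 18): "The map `i` is an injective homomorphism of
`ℤ_p[[𝒢]]`-modules"; II.4.6 (p. 59): "There exists a unique `𝒢`-homomorphism `i : 𝒰 → Λ(𝒢, R̂)`,
`i(β) = μ_β`, satisfying (14)".  The sibling files constructed, for a norm-coherent unit `β` of the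
Lubin–Tate tower of `f' = π'X + X²` (`π' = 2u`, residue field `𝔽₂`, `2` a uniformizer), the series
`H_β = Θ((δβ)~ ∘ ϑ)`, its inverse Amice transform `ν_β = D_{H_β}`, the unit-ball measure
`ν_β♭ = (x⁻¹ ν_β)|_{ℤ₂^×}` and its pull-back `D_β = comap ν_β♭ ψ` to `Γ_F` along the Lubin–Tate tower with
`κ = e ∘ χ_{π'}`; and proved the support, the socket, the moments (`…MomentsTwo`), Lemma 3.4 (ii) and the
`U_0`-equivariance `hD` (`…ComapEquivariantTwo`).  THIS file supplies the remaining input of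
`GroupDistribution.induce` / `…DivisionAssembly` — ADDITIVITY — and packages `i := induce D`:

* (generic input: `PAdicDistributionAdditivity.lean` — `density`, `restrictUnits`, `comap`, `invAmice₁` of a
  levelwise sum / of zero)
* §2 `H_{ββ'} = H_β + H_{β'}`, `H_1 = 0` (`logDeriv_mul`, `tildeSer_add`, `PowerSeries.subst_add`) and
  ★ `comap_μ_normCoherentUnits_mul` / `comap_μ_normCoherentUnits_one`: **`D_{ββ'} = D_β + D_{β'}`, `D_1 = 0`**
  levelwise (I.3.4 Lemma (i));
* §3 at residue field `𝔽₂` the top level of the Lubin–Tate tower is everything: `mem_ltTower_U_zero`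
  (`Gal(F̄/K_{π'}^1) = Γ_F` as `(𝒪_F/π')ˣ = 1`), so `induce D β` READS `D β` on every cell
  (`induce_μ_eq_normCoherentUnits`);
* §4 for a `Γ_F`-monoid `B` mapped multiplicatively and equivariantly to the norm-coherent units
  (`η (b b') = η b · η b'`, `η 1 = 1`, `η (σ • b) = (η b).galAct σ`): ★★ `induce_μ_mul_normCoherentUnits`,
  `induce_μ_one_normCoherentUnits`, `induce_μ_pow_normCoherentUnits` (additivity / homogeneity of `i`) and
  ★★ `induce_μ_smul_normCoherentUnits` (**`i(σ b)(σ̄ a) = i(b)(a)`**, the `𝒢`-homomorphism property, from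
  the sibling's `hD`) — de Shalit's I.3.4 Corollary at `p = 2` for the local tower, in the exact currency
  of `exists_twisting_μ_eq_forall_of_units` (`hadd`, `hequiv`).

Everything is proved; no named facts, no definitions, no instances (section-local instance attributes as
in the siblings), no `sorry`.

## References

* [deShalit1987] E. de Shalit, *Iwasawa theory of elliptic curves with complex multiplication* (1987),
  I.3.4 Lemma (i), (ii) and Corollary (p. 18), II.4.6 (14) (p. 59), I.3.3 (9) (p. 18).
-/

noncomputable section

open MvPowerSeries Filter
open scoped Topology Classical

namespace Literature.NumberTheory.EllipticCurves

/-! ### §2. `H_{ββ'} = H_β + H_{β'}`, `H_1 = 0`, and the additivity of `β ↦ D_β` (de Shalit I.3.4 Lemma (i)) -/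

section NormCoherentUnitFamilyTwo

open ValuativeRel IsLocalRing Field
open Literature.NumberTheory.GaloisRepresentations Literature.NumberTheory.GaloisRepresentations.IsNonarchimedeanLocalField
  Literature.NumberTheory.GaloisRepresentations.LubinTate Literature.NumberTheory.PAdicHodge

variable {F : Type} [Field F] [ValuativeRel F] [TopologicalSpace F] [IsNonarchimedeanLocalField F]

attribute [local instance] ltNormUniformSpace ltNormIsUniformAddGroup rk1 nF nE fintypeResidueField
attribute [local instance] ltTower_U_normal

variable (hq : residueFieldCard F = 2) (h2 : (valuation F).IsUniformizer (((2 : ℕ) : 𝒪[F]) : F))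
  {σ₀ : absoluteGaloisGroup F} (hσ₀ : IsAbsArithFrob σ₀) (u : 𝒪[F]ˣ)
  {ε : (maxUnramifiedCompletion F)ˣ}
  (hε : maxUnramifiedCompletion.galAut F σ₀ (ε : maxUnramifiedCompletion F) =
    algebraMap 𝒪[F] (maxUnramifiedCompletion F) (u : 𝒪[F]) * (ε : maxUnramifiedCompletion F))
variable {𝕜 : Type*} [NormedField 𝕜] [NormedAlgebra ℚ_[2] 𝕜] [IsUltrametricDist 𝕜] [CompleteSpace 𝕜]
  (Θ : UnrCoeff F →+* 𝕜)

omit [NormedAlgebra ℚ_[2] 𝕜] [IsUltrametricDist 𝕜] [CompleteSpace 𝕜] in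
/-- **`H_{ββ'} = H_β + H_{β'}`** for the series `H_β = Θ((δβ)~ ∘ ϑ)` of the measure of `β`
(`δ(ββ') = δβ + δβ'`, `(·)~`, `∘ ϑ` and `Θ` additive). [cite: deShalit1987, I.3.4 Lemma (i) (p. 18)] -/
theorem map_subst_tildeSer_logDeriv_mul (β β' : NormCoherentUnits (isUniformizer_unit_mul h2 u)) :
    ((PowerSeries.subst (compSeriesC h2 hσ₀ u hε)
          ((tildeSer ((u : 𝒪[F]) * ((2 : ℕ) : 𝒪[F])) (LTCoeff.of F (u : 𝒪[F])) (β.mul β').logDeriv).map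
            ((intToUnrCoeff F).comp (LTCoeff.of F).symm.toRingHom))).map Θ) =
      ((PowerSeries.subst (compSeriesC h2 hσ₀ u hε)
          ((tildeSer ((u : 𝒪[F]) * ((2 : ℕ) : 𝒪[F])) (LTCoeff.of F (u : 𝒪[F])) β.logDeriv).map
            ((intToUnrCoeff F).comp (LTCoeff.of F).symm.toRingHom))).map Θ) +
        ((PowerSeries.subst (compSeriesC h2 hσ₀ u hε)
          ((tildeSer ((u : 𝒪[F]) * ((2 : ℕ) : 𝒪[F])) (LTCoeff.of F (u : 𝒪[F])) β'.logDeriv).map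
            ((intToUnrCoeff F).comp (LTCoeff.of F).symm.toRingHom))).map Θ) := by
  rw [NormCoherentUnits.logDeriv_mul, tildeSer_add, map_add,
    PowerSeries.subst_add (hasSubst_compSeriesC h2 hσ₀ u hε), map_add]

omit [NormedAlgebra ℚ_[2] 𝕜] [IsUltrametricDist 𝕜] [CompleteSpace 𝕜] in
/-- **`H_1 = 0`** (`δ1 = 0`). [cite: deShalit1987, I.3.4 Lemma (i) (p. 18)] -/
theorem map_subst_tildeSer_logDeriv_one :
    ((PowerSeries.subst (compSeriesC h2 hσ₀ u hε)
          ((tildeSer ((u : 𝒪[F]) * ((2 : ℕ) : 𝒪[F])) (LTCoeff.of F (u : 𝒪[F])) (NormCoherentUnits.one : NormCoherentUnits (isUniformizer_unit_mul h2 u)).logDeriv).map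
            ((intToUnrCoeff F).comp (LTCoeff.of F).symm.toRingHom))).map Θ) = 0 := by
  have h0 : tildeSer ((u : 𝒪[F]) * ((2 : ℕ) : 𝒪[F])) (LTCoeff.of F (u : 𝒪[F])) 0 = 0 := by
    have h := tildeSer_add (π := (u : 𝒪[F]) * ((2 : ℕ) : 𝒪[F])) (LTCoeff.of F (u : 𝒪[F])) 0 0
    rw [add_zero] at h
    exact left_eq_add.mp h
  rw [NormCoherentUnits.logDeriv_one, h0, map_zero, ← PowerSeries.coe_substAlgHom (hasSubst_compSeriesC h2 hσ₀ u hε),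
    map_zero, map_zero]

variable (e : 𝒪[F] ≃+* ℤ_[2])
  (ψ : (n : ℕ) → absoluteGaloisGroup F ⧸ (ltTower (isUniformizer_unit_mul h2 u)).U n → ZMod (2 ^ (n + 1)))
  (hψ : ∀ (n : ℕ) (σ : absoluteGaloisGroup F), σ ∈ (ltTower (isUniformizer_unit_mul h2 u)).U 0 →
    ψ n ((ltTower (isUniformizer_unit_mul h2 u)).proj n σ) = PadicInt.toZModPow (n + 1)
      (((Units.map (e : 𝒪[F] →+* ℤ_[2]).toMonoidHom).comp (lubinTateCharHom (isUniformizer_unit_mul h2 u)) σ :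
        ℤ_[2]ˣ) : ℤ_[2]))

/-- ★ **`D_{ββ'} = D_β + D_{β'}` levelwise** for the pulled-back log-free measures
`D_β = comap ((x⁻¹ D_{H_β})|_{ℤ₂^×}) ψ` of norm-coherent units along the Lubin–Tate tower of `f' = π'X + X²`
(`H ↦ D_H`, `density`, `(·)|_{ℤ₂^×}` and `comap` are additive in the level data).
[cite: deShalit1987, I.3.4 Lemma (i) (p. 18), II.4.6 (p. 59)] -/
theorem comap_μ_normCoherentUnits_mul (β β' : NormCoherentUnits (isUniformizer_unit_mul h2 u)) {C C₁ C₂ : ℝ}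
    (hC : ∀ k : ℕ, ‖PowerSeries.coeff k ((PowerSeries.subst (compSeriesC h2 hσ₀ u hε)
          ((tildeSer ((u : 𝒪[F]) * ((2 : ℕ) : 𝒪[F])) (LTCoeff.of F (u : 𝒪[F])) (β.mul β').logDeriv).map
            ((intToUnrCoeff F).comp (LTCoeff.of F).symm.toRingHom))).map Θ)‖ ≤ C)
    (hC₁ : ∀ k : ℕ, ‖PowerSeries.coeff k ((PowerSeries.subst (compSeriesC h2 hσ₀ u hε)
          ((tildeSer ((u : 𝒪[F]) * ((2 : ℕ) : 𝒪[F])) (LTCoeff.of F (u : 𝒪[F])) β.logDeriv).map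
            ((intToUnrCoeff F).comp (LTCoeff.of F).symm.toRingHom))).map Θ)‖ ≤ C₁)
    (hC₂ : ∀ k : ℕ, ‖PowerSeries.coeff k ((PowerSeries.subst (compSeriesC h2 hσ₀ u hε)
          ((tildeSer ((u : 𝒪[F]) * ((2 : ℕ) : 𝒪[F])) (LTCoeff.of F (u : 𝒪[F])) β'.logDeriv).map
            ((intToUnrCoeff F).comp (LTCoeff.of F).symm.toRingHom))).map Θ)‖ ≤ C₂)
    (n : ℕ) (a : absoluteGaloisGroup F ⧸ (ltTower (isUniformizer_unit_mul h2 u)).U n) :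
    (GroupDistribution.comap (restrictUnits ((invAmice₁ 2 ((PowerSeries.subst (compSeriesC h2 hσ₀ u hε)
          ((tildeSer ((u : 𝒪[F]) * ((2 : ℕ) : 𝒪[F])) (LTCoeff.of F (u : 𝒪[F])) (β.mul β').logDeriv).map
            ((intToUnrCoeff F).comp (LTCoeff.of F).symm.toRingHom))).map Θ) hC).density
          (ProfiniteTower.padicInt_isUniform 2) (unitInv 𝕜) uniformContinuous_unitInv norm_unitInv_le))
          ψ ((ltTower (isUniformizer_unit_mul h2 u)).cellMap_trans _ ψ hψ)
          ((ltTower (isUniformizer_unit_mul h2 u)).cellMap_injective _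
            (mem_ltTower_iff (isUniformizer_unit_mul h2 u) e) ψ hψ)
          ((ltTower (isUniformizer_unit_mul h2 u)).cellMap_fiberSurj _
            (mem_ltTower_iff (isUniformizer_unit_mul h2 u) e)
            (exists_toZModPow_ltCharacter_eq (isUniformizer_unit_mul h2 u) e) ψ hψ)).μ n a =
      (GroupDistribution.comap (restrictUnits ((invAmice₁ 2 ((PowerSeries.subst (compSeriesC h2 hσ₀ u hε)
          ((tildeSer ((u : 𝒪[F]) * ((2 : ℕ) : 𝒪[F])) (LTCoeff.of F (u : 𝒪[F])) β.logDeriv).map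
            ((intToUnrCoeff F).comp (LTCoeff.of F).symm.toRingHom))).map Θ) hC₁).density
          (ProfiniteTower.padicInt_isUniform 2) (unitInv 𝕜) uniformContinuous_unitInv norm_unitInv_le))
          ψ ((ltTower (isUniformizer_unit_mul h2 u)).cellMap_trans _ ψ hψ)
          ((ltTower (isUniformizer_unit_mul h2 u)).cellMap_injective _
            (mem_ltTower_iff (isUniformizer_unit_mul h2 u) e) ψ hψ)
          ((ltTower (isUniformizer_unit_mul h2 u)).cellMap_fiberSurj _
            (mem_ltTower_iff (isUniformizer_unit_mul h2 u) e)
            (exists_toZModPow_ltCharacter_eq (isUniformizer_unit_mul h2 u) e) ψ hψ)).μ n a +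
        (GroupDistribution.comap (restrictUnits ((invAmice₁ 2 ((PowerSeries.subst (compSeriesC h2 hσ₀ u hε)
          ((tildeSer ((u : 𝒪[F]) * ((2 : ℕ) : 𝒪[F])) (LTCoeff.of F (u : 𝒪[F])) β'.logDeriv).map
            ((intToUnrCoeff F).comp (LTCoeff.of F).symm.toRingHom))).map Θ) hC₂).density
          (ProfiniteTower.padicInt_isUniform 2) (unitInv 𝕜) uniformContinuous_unitInv norm_unitInv_le))
          ψ ((ltTower (isUniformizer_unit_mul h2 u)).cellMap_trans _ ψ hψ)
          ((ltTower (isUniformizer_unit_mul h2 u)).cellMap_injective _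
            (mem_ltTower_iff (isUniformizer_unit_mul h2 u) e) ψ hψ)
          ((ltTower (isUniformizer_unit_mul h2 u)).cellMap_fiberSurj _
            (mem_ltTower_iff (isUniformizer_unit_mul h2 u) e)
            (exists_toZModPow_ltCharacter_eq (isUniformizer_unit_mul h2 u) e) ψ hψ)).μ n a := by
  have h₁ := invAmice₁_μ_eq_add_of_eq_add (p := 2) (map_subst_tildeSer_logDeriv_mul h2 hσ₀ u hε Θ β β') hC hC₁ hC₂
  have h₂ := BoundedDistribution.density_μ_eq_add_of_μ_eq_add _ _ _ h₁ (ProfiniteTower.padicInt_isUniform 2)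
    (unitInv 𝕜) uniformContinuous_unitInv norm_unitInv_le
  have h₃ := restrictUnits_μ_eq_add_of_μ_eq_add _ _ _ h₂
  exact GroupDistribution.comap_μ_eq_add_of_μ_eq_add (T := (ProfiniteTower.padicInt 2).succ) _ _ _ ψ _ _ _ h₃ n a

/-- ★ **`D_1 = 0` levelwise.** [cite: deShalit1987, I.3.4 Lemma (i) (p. 18)] -/
theorem comap_μ_normCoherentUnits_one {C : ℝ}
    (hC : ∀ k : ℕ, ‖PowerSeries.coeff k ((PowerSeries.subst (compSeriesC h2 hσ₀ u hε)
          ((tildeSer ((u : 𝒪[F]) * ((2 : ℕ) : 𝒪[F])) (LTCoeff.of F (u : 𝒪[F])) (NormCoherentUnits.one : NormCoherentUnits (isUniformizer_unit_mul h2 u)).logDeriv).map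
            ((intToUnrCoeff F).comp (LTCoeff.of F).symm.toRingHom))).map Θ)‖ ≤ C)
    (n : ℕ) (a : absoluteGaloisGroup F ⧸ (ltTower (isUniformizer_unit_mul h2 u)).U n) :
    (GroupDistribution.comap (restrictUnits ((invAmice₁ 2 ((PowerSeries.subst (compSeriesC h2 hσ₀ u hε)
          ((tildeSer ((u : 𝒪[F]) * ((2 : ℕ) : 𝒪[F])) (LTCoeff.of F (u : 𝒪[F])) (NormCoherentUnits.one : NormCoherentUnits (isUniformizer_unit_mul h2 u)).logDeriv).map
            ((intToUnrCoeff F).comp (LTCoeff.of F).symm.toRingHom))).map Θ) hC).density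
          (ProfiniteTower.padicInt_isUniform 2) (unitInv 𝕜) uniformContinuous_unitInv norm_unitInv_le))
          ψ ((ltTower (isUniformizer_unit_mul h2 u)).cellMap_trans _ ψ hψ)
          ((ltTower (isUniformizer_unit_mul h2 u)).cellMap_injective _
            (mem_ltTower_iff (isUniformizer_unit_mul h2 u) e) ψ hψ)
          ((ltTower (isUniformizer_unit_mul h2 u)).cellMap_fiberSurj _
            (mem_ltTower_iff (isUniformizer_unit_mul h2 u) e)
            (exists_toZModPow_ltCharacter_eq (isUniformizer_unit_mul h2 u) e) ψ hψ)).μ n a = 0 := by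
  have h₁ := invAmice₁_μ_eq_zero_of_eq_zero (p := 2) (map_subst_tildeSer_logDeriv_one h2 hσ₀ u hε Θ) hC
  have h₂ := BoundedDistribution.density_μ_eq_zero_of_μ_eq_zero _ h₁ (ProfiniteTower.padicInt_isUniform 2)
    (unitInv 𝕜) uniformContinuous_unitInv norm_unitInv_le
  have h₃ := restrictUnits_μ_eq_zero_of_μ_eq_zero _ h₂
  exact GroupDistribution.comap_μ_eq_zero_of_μ_eq_zero (T := (ProfiniteTower.padicInt 2).succ) _ ψ _ _ _ h₃ n a

/-! ### §3. At residue field `𝔽₂` the top level of the Lubin–Tate tower is all of `Γ_F` -/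

include e in
/-- **`U_0 = Gal(F̄/K_{π'}^1) = Γ_F` when `𝒪_F ≅ ℤ₂`**: `(𝒪_F/π')ˣ ≅ (ℤ/2)ˣ` is trivial, so every `σ`
lies in the top level of the Lubin–Tate tower (de Shalit's `k' = k_ξ^0`… at `q = 2` the first layer
`K_{π'}^1/F` has degree `q − 1 = 1`). [cite: deShalit1987, I.3.3 (9) (p. 18)]
[cite: CasselsFrohlichANT1967, Ch. VI §3.6 Prop. 6 (b)] -/
theorem mem_ltTower_U_zero (σ : absoluteGaloisGroup F) : σ ∈ (ltTower (isUniformizer_unit_mul h2 u)).U 0 := by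
  rw [mem_ltTower_U_iff_toZModPow (isUniformizer_unit_mul h2 u) e 0 σ]
  have key : ∀ z : ZMod (2 ^ (0 + 1)), IsUnit z → z = 1 := by decide
  exact key _ ((Units.isUnit _).map _)

include e in
/-- Every cell of the Lubin–Tate tower at `q = 2` lies over the trivial top-level cell.
[cite: deShalit1987, I.3.3 (9) (p. 18)] -/
theorem ltTower_transLE_zero_eq_one (n : ℕ) (a : absoluteGaloisGroup F ⧸ (ltTower (isUniformizer_unit_mul h2 u)).U n) :
    (ltTower (isUniformizer_unit_mul h2 u)).transLE (Nat.zero_le n) a = 1 := by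
  induction a using QuotientGroup.induction_on with
  | H σ =>
    rw [← SubgroupTower.proj_apply, SubgroupTower.transLE_proj, SubgroupTower.proj_apply, QuotientGroup.eq_one_iff]
    exact mem_ltTower_U_zero h2 u e σ

/-! ### §4. `i := induce D` for a `Γ_F`-monoid mapped to the norm-coherent units: de Shalit's I.3.4 Corollary -/

variable (hΘe : ∀ a : 𝒪[F], Θ (intToUnrCoeff F a) = padicIntCast 𝕜 ((e : 𝒪[F] →+* ℤ_[2]) a))
variable {B : Type*} [Monoid B] [MulDistribMulAction (absoluteGaloisGroup F) B]
  (η : B → NormCoherentUnits (isUniformizer_unit_mul h2 u))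
  (hηmul : ∀ b b' : B, η (b * b') = (η b).mul (η b'))
  (hη : ∀ (σ : absoluteGaloisGroup F) (b : B), η (σ • b) = (η b).galAct σ)
  {C : ℝ}
  (hC : ∀ (b : B) (k : ℕ), ‖PowerSeries.coeff k ((PowerSeries.subst (compSeriesC h2 hσ₀ u hε)
          ((tildeSer ((u : 𝒪[F]) * ((2 : ℕ) : 𝒪[F])) (LTCoeff.of F (u : 𝒪[F])) (η b).logDeriv).map
            ((intToUnrCoeff F).comp (LTCoeff.of F).symm.toRingHom))).map Θ)‖ ≤ C)
  (hC0 : 0 ≤ C)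
  (hCb : ∀ b : B, (GroupDistribution.comap (restrictUnits ((invAmice₁ 2 ((PowerSeries.subst (compSeriesC h2 hσ₀ u hε)
          ((tildeSer ((u : 𝒪[F]) * ((2 : ℕ) : 𝒪[F])) (LTCoeff.of F (u : 𝒪[F])) (η b).logDeriv).map
            ((intToUnrCoeff F).comp (LTCoeff.of F).symm.toRingHom))).map Θ) (hC b)).density
          (ProfiniteTower.padicInt_isUniform 2) (unitInv 𝕜) uniformContinuous_unitInv norm_unitInv_le))
          ψ ((ltTower (isUniformizer_unit_mul h2 u)).cellMap_trans _ ψ hψ)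
          ((ltTower (isUniformizer_unit_mul h2 u)).cellMap_injective _
            (mem_ltTower_iff (isUniformizer_unit_mul h2 u) e) ψ hψ)
          ((ltTower (isUniformizer_unit_mul h2 u)).cellMap_fiberSurj _
            (mem_ltTower_iff (isUniformizer_unit_mul h2 u) e)
            (exists_toZModPow_ltCharacter_eq (isUniformizer_unit_mul h2 u) e) ψ hψ)).bound ≤ C)

include hηmul in
/-- ★★ **Additivity of `i`: `i(bb')_n(a) = i(b)_n(a) + i(b')_n(a)`** for `i := induce D`, `D b = D_{η b}` — de Shalit
I.3.4 Corollary ("`i` is a homomorphism"), the hypothesis `hadd` of `exists_twisting_μ_eq_forall_of_units`.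
[cite: deShalit1987, I.3.4 Lemma (i) and Corollary (p. 18), II.4.6 (p. 59)] -/
theorem induce_μ_mul_normCoherentUnits (b b' : B) (n : ℕ)
    (a : absoluteGaloisGroup F ⧸ (ltTower (isUniformizer_unit_mul h2 u)).U n) :
    (GroupDistribution.induce (fun b ↦ (GroupDistribution.comap (restrictUnits ((invAmice₁ 2 ((PowerSeries.subst (compSeriesC h2 hσ₀ u hε)
          ((tildeSer ((u : 𝒪[F]) * ((2 : ℕ) : 𝒪[F])) (LTCoeff.of F (u : 𝒪[F])) (η b).logDeriv).map
            ((intToUnrCoeff F).comp (LTCoeff.of F).symm.toRingHom))).map Θ) (hC b)).density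
          (ProfiniteTower.padicInt_isUniform 2) (unitInv 𝕜) uniformContinuous_unitInv norm_unitInv_le))
          ψ ((ltTower (isUniformizer_unit_mul h2 u)).cellMap_trans _ ψ hψ)
          ((ltTower (isUniformizer_unit_mul h2 u)).cellMap_injective _
            (mem_ltTower_iff (isUniformizer_unit_mul h2 u) e) ψ hψ)
          ((ltTower (isUniformizer_unit_mul h2 u)).cellMap_fiberSurj _
            (mem_ltTower_iff (isUniformizer_unit_mul h2 u) e)
            (exists_toZModPow_ltCharacter_eq (isUniformizer_unit_mul h2 u) e) ψ hψ))) hC0 hCb (b * b')).μ n a =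
      (GroupDistribution.induce (fun b ↦ (GroupDistribution.comap (restrictUnits ((invAmice₁ 2 ((PowerSeries.subst (compSeriesC h2 hσ₀ u hε)
          ((tildeSer ((u : 𝒪[F]) * ((2 : ℕ) : 𝒪[F])) (LTCoeff.of F (u : 𝒪[F])) (η b).logDeriv).map
            ((intToUnrCoeff F).comp (LTCoeff.of F).symm.toRingHom))).map Θ) (hC b)).density
          (ProfiniteTower.padicInt_isUniform 2) (unitInv 𝕜) uniformContinuous_unitInv norm_unitInv_le))
          ψ ((ltTower (isUniformizer_unit_mul h2 u)).cellMap_trans _ ψ hψ)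
          ((ltTower (isUniformizer_unit_mul h2 u)).cellMap_injective _
            (mem_ltTower_iff (isUniformizer_unit_mul h2 u) e) ψ hψ)
          ((ltTower (isUniformizer_unit_mul h2 u)).cellMap_fiberSurj _
            (mem_ltTower_iff (isUniformizer_unit_mul h2 u) e)
            (exists_toZModPow_ltCharacter_eq (isUniformizer_unit_mul h2 u) e) ψ hψ))) hC0 hCb b).μ n a +
        (GroupDistribution.induce (fun b ↦ (GroupDistribution.comap (restrictUnits ((invAmice₁ 2 ((PowerSeries.subst (compSeriesC h2 hσ₀ u hε)
          ((tildeSer ((u : 𝒪[F]) * ((2 : ℕ) : 𝒪[F])) (LTCoeff.of F (u : 𝒪[F])) (η b).logDeriv).map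
            ((intToUnrCoeff F).comp (LTCoeff.of F).symm.toRingHom))).map Θ) (hC b)).density
          (ProfiniteTower.padicInt_isUniform 2) (unitInv 𝕜) uniformContinuous_unitInv norm_unitInv_le))
          ψ ((ltTower (isUniformizer_unit_mul h2 u)).cellMap_trans _ ψ hψ)
          ((ltTower (isUniformizer_unit_mul h2 u)).cellMap_injective _
            (mem_ltTower_iff (isUniformizer_unit_mul h2 u) e) ψ hψ)
          ((ltTower (isUniformizer_unit_mul h2 u)).cellMap_fiberSurj _
            (mem_ltTower_iff (isUniformizer_unit_mul h2 u) e)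
            (exists_toZModPow_ltCharacter_eq (isUniformizer_unit_mul h2 u) e) ψ hψ))) hC0 hCb b').μ n a := by
  refine GroupDistribution.induce_μ_mul _ hC0 hCb (fun b b' n a ↦ ?_) b b' n a
  have hC' : ∀ k : ℕ, ‖PowerSeries.coeff k ((PowerSeries.subst (compSeriesC h2 hσ₀ u hε)
          ((tildeSer ((u : 𝒪[F]) * ((2 : ℕ) : 𝒪[F])) (LTCoeff.of F (u : 𝒪[F])) ((η b).mul (η b')).logDeriv).map
            ((intToUnrCoeff F).comp (LTCoeff.of F).symm.toRingHom))).map Θ)‖ ≤ C := by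
    rw [← hηmul]; exact hC (b * b')
  have key := comap_μ_normCoherentUnits_mul h2 hσ₀ u hε Θ e ψ hψ (η b) (η b') hC' (hC b) (hC b') n a
  simp only [hηmul]
  convert key using 2

include hηmul in
/-- **`i(1) = 0`** levelwise (from additivity: `i(1) = i(1·1) = 2·i(1)`). [cite: deShalit1987, I.3.4 Lemma (i) (p. 18)] -/
theorem induce_μ_one_normCoherentUnits (n : ℕ) (a : absoluteGaloisGroup F ⧸ (ltTower (isUniformizer_unit_mul h2 u)).U n) :
    (GroupDistribution.induce (fun b ↦ (GroupDistribution.comap (restrictUnits ((invAmice₁ 2 ((PowerSeries.subst (compSeriesC h2 hσ₀ u hε)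
          ((tildeSer ((u : 𝒪[F]) * ((2 : ℕ) : 𝒪[F])) (LTCoeff.of F (u : 𝒪[F])) (η b).logDeriv).map
            ((intToUnrCoeff F).comp (LTCoeff.of F).symm.toRingHom))).map Θ) (hC b)).density
          (ProfiniteTower.padicInt_isUniform 2) (unitInv 𝕜) uniformContinuous_unitInv norm_unitInv_le))
          ψ ((ltTower (isUniformizer_unit_mul h2 u)).cellMap_trans _ ψ hψ)
          ((ltTower (isUniformizer_unit_mul h2 u)).cellMap_injective _
            (mem_ltTower_iff (isUniformizer_unit_mul h2 u) e) ψ hψ)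
          ((ltTower (isUniformizer_unit_mul h2 u)).cellMap_fiberSurj _
            (mem_ltTower_iff (isUniformizer_unit_mul h2 u) e)
            (exists_toZModPow_ltCharacter_eq (isUniformizer_unit_mul h2 u) e) ψ hψ))) hC0 hCb 1).μ n a = 0 := by
  have h := induce_μ_mul_normCoherentUnits h2 hσ₀ u hε Θ e ψ hψ η hηmul hC hC0 hCb 1 1 n a
  rw [mul_one] at h
  exact left_eq_add.mp h

include hηmul in
/-- **Homogeneity `i(b^N) = N · i(b)`** levelwise (the `12` of `μ_𝔞 = 12·δ_𝔞·μ(𝔣)` and the `N𝔞` of II.2.4 (ii)).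
[cite: deShalit1987, I.3.4 Lemma (i) (p. 18), II.4.12 (p. 69)] -/
theorem induce_μ_pow_normCoherentUnits (b : B) (N n : ℕ)
    (a : absoluteGaloisGroup F ⧸ (ltTower (isUniformizer_unit_mul h2 u)).U n) :
    (GroupDistribution.induce (fun b ↦ (GroupDistribution.comap (restrictUnits ((invAmice₁ 2 ((PowerSeries.subst (compSeriesC h2 hσ₀ u hε)
          ((tildeSer ((u : 𝒪[F]) * ((2 : ℕ) : 𝒪[F])) (LTCoeff.of F (u : 𝒪[F])) (η b).logDeriv).map
            ((intToUnrCoeff F).comp (LTCoeff.of F).symm.toRingHom))).map Θ) (hC b)).density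
          (ProfiniteTower.padicInt_isUniform 2) (unitInv 𝕜) uniformContinuous_unitInv norm_unitInv_le))
          ψ ((ltTower (isUniformizer_unit_mul h2 u)).cellMap_trans _ ψ hψ)
          ((ltTower (isUniformizer_unit_mul h2 u)).cellMap_injective _
            (mem_ltTower_iff (isUniformizer_unit_mul h2 u) e) ψ hψ)
          ((ltTower (isUniformizer_unit_mul h2 u)).cellMap_fiberSurj _
            (mem_ltTower_iff (isUniformizer_unit_mul h2 u) e)
            (exists_toZModPow_ltCharacter_eq (isUniformizer_unit_mul h2 u) e) ψ hψ))) hC0 hCb (b ^ N)).μ n a =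
      (N : 𝕜) * (GroupDistribution.induce (fun b ↦ (GroupDistribution.comap (restrictUnits ((invAmice₁ 2 ((PowerSeries.subst (compSeriesC h2 hσ₀ u hε)
          ((tildeSer ((u : 𝒪[F]) * ((2 : ℕ) : 𝒪[F])) (LTCoeff.of F (u : 𝒪[F])) (η b).logDeriv).map
            ((intToUnrCoeff F).comp (LTCoeff.of F).symm.toRingHom))).map Θ) (hC b)).density
          (ProfiniteTower.padicInt_isUniform 2) (unitInv 𝕜) uniformContinuous_unitInv norm_unitInv_le))
          ψ ((ltTower (isUniformizer_unit_mul h2 u)).cellMap_trans _ ψ hψ)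
          ((ltTower (isUniformizer_unit_mul h2 u)).cellMap_injective _
            (mem_ltTower_iff (isUniformizer_unit_mul h2 u) e) ψ hψ)
          ((ltTower (isUniformizer_unit_mul h2 u)).cellMap_fiberSurj _
            (mem_ltTower_iff (isUniformizer_unit_mul h2 u) e)
            (exists_toZModPow_ltCharacter_eq (isUniformizer_unit_mul h2 u) e) ψ hψ))) hC0 hCb b).μ n a := by
  induction N with
  | zero => rw [pow_zero b, induce_μ_one_normCoherentUnits h2 hσ₀ u hε Θ e ψ hψ η hηmul hC hC0 hCb, Nat.cast_zero,
      zero_mul]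
  | succ N ih => rw [pow_succ b N, induce_μ_mul_normCoherentUnits h2 hσ₀ u hε Θ e ψ hψ η hηmul hC hC0 hCb, ih,
      Nat.cast_add_one N]; ring

include hq hΘe hη in
/-- ★★ **`i` is a `Γ_F`-homomorphism: `i(σ • b)_n(σ̄ a) = i(b)_n(a)`** for EVERY `σ ∈ Γ_F` (de Shalit I.3.4
Corollary / II.4.6: "`i` is a `𝒢`-homomorphism", i.e. `i(σβ) = δ_σ * i(β)`), from the `U_0`-equivariance of the
sibling file (`comap_μ_proj_mul_normCoherentUnits`) through `GroupDistribution.induce_μ_smul` — the hypothesis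
`hequiv` of `exists_twisting_μ_eq_forall_of_units`. [cite: deShalit1987, I.3.4 Lemma (ii) and Corollary (p. 18), II.4.6 (14) (p. 59)] -/
theorem induce_μ_smul_normCoherentUnits (σ : absoluteGaloisGroup F) (b : B) (n : ℕ)
    (a : absoluteGaloisGroup F ⧸ (ltTower (isUniformizer_unit_mul h2 u)).U n) :
    (GroupDistribution.induce (fun b ↦ (GroupDistribution.comap (restrictUnits ((invAmice₁ 2 ((PowerSeries.subst (compSeriesC h2 hσ₀ u hε)
          ((tildeSer ((u : 𝒪[F]) * ((2 : ℕ) : 𝒪[F])) (LTCoeff.of F (u : 𝒪[F])) (η b).logDeriv).map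
            ((intToUnrCoeff F).comp (LTCoeff.of F).symm.toRingHom))).map Θ) (hC b)).density
          (ProfiniteTower.padicInt_isUniform 2) (unitInv 𝕜) uniformContinuous_unitInv norm_unitInv_le))
          ψ ((ltTower (isUniformizer_unit_mul h2 u)).cellMap_trans _ ψ hψ)
          ((ltTower (isUniformizer_unit_mul h2 u)).cellMap_injective _
            (mem_ltTower_iff (isUniformizer_unit_mul h2 u) e) ψ hψ)
          ((ltTower (isUniformizer_unit_mul h2 u)).cellMap_fiberSurj _
            (mem_ltTower_iff (isUniformizer_unit_mul h2 u) e)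
            (exists_toZModPow_ltCharacter_eq (isUniformizer_unit_mul h2 u) e) ψ hψ))) hC0 hCb (σ • b)).μ n
        ((ltTower (isUniformizer_unit_mul h2 u)).proj n σ * a) =
      (GroupDistribution.induce (fun b ↦ (GroupDistribution.comap (restrictUnits ((invAmice₁ 2 ((PowerSeries.subst (compSeriesC h2 hσ₀ u hε)
          ((tildeSer ((u : 𝒪[F]) * ((2 : ℕ) : 𝒪[F])) (LTCoeff.of F (u : 𝒪[F])) (η b).logDeriv).map
            ((intToUnrCoeff F).comp (LTCoeff.of F).symm.toRingHom))).map Θ) (hC b)).density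
          (ProfiniteTower.padicInt_isUniform 2) (unitInv 𝕜) uniformContinuous_unitInv norm_unitInv_le))
          ψ ((ltTower (isUniformizer_unit_mul h2 u)).cellMap_trans _ ψ hψ)
          ((ltTower (isUniformizer_unit_mul h2 u)).cellMap_injective _
            (mem_ltTower_iff (isUniformizer_unit_mul h2 u) e) ψ hψ)
          ((ltTower (isUniformizer_unit_mul h2 u)).cellMap_fiberSurj _
            (mem_ltTower_iff (isUniformizer_unit_mul h2 u) e)
            (exists_toZModPow_ltCharacter_eq (isUniformizer_unit_mul h2 u) e) ψ hψ))) hC0 hCb b).μ n a :=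
  GroupDistribution.induce_μ_smul _ hC0 hCb
    (comap_μ_proj_mul_normCoherentUnits hq h2 hσ₀ u hε Θ e hΘe η hη hC ψ hψ) σ b n a

include hq hΘe hη in
/-- **At `q = 2`, `i(b)` READS `D_{η b}` on every cell** (`U_0 = Γ_F`, `mem_ltTower_U_zero`): the coset
extension is the identity extension for the absolute tower over `F ≅ ℚ₂` (the coset sum of II.4.7 (16) is
the semi-local one over the primes above `𝔭`, not a local one). [cite: deShalit1987, I.3.4 (p. 18), II.4.7 (16) (p. 60)] -/
theorem induce_μ_eq_normCoherentUnits (b : B) (n : ℕ)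
    (a : absoluteGaloisGroup F ⧸ (ltTower (isUniformizer_unit_mul h2 u)).U n) :
    (GroupDistribution.induce (fun b ↦ (GroupDistribution.comap (restrictUnits ((invAmice₁ 2 ((PowerSeries.subst (compSeriesC h2 hσ₀ u hε)
          ((tildeSer ((u : 𝒪[F]) * ((2 : ℕ) : 𝒪[F])) (LTCoeff.of F (u : 𝒪[F])) (η b).logDeriv).map
            ((intToUnrCoeff F).comp (LTCoeff.of F).symm.toRingHom))).map Θ) (hC b)).density
          (ProfiniteTower.padicInt_isUniform 2) (unitInv 𝕜) uniformContinuous_unitInv norm_unitInv_le))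
          ψ ((ltTower (isUniformizer_unit_mul h2 u)).cellMap_trans _ ψ hψ)
          ((ltTower (isUniformizer_unit_mul h2 u)).cellMap_injective _
            (mem_ltTower_iff (isUniformizer_unit_mul h2 u) e) ψ hψ)
          ((ltTower (isUniformizer_unit_mul h2 u)).cellMap_fiberSurj _
            (mem_ltTower_iff (isUniformizer_unit_mul h2 u) e)
            (exists_toZModPow_ltCharacter_eq (isUniformizer_unit_mul h2 u) e) ψ hψ))) hC0 hCb b).μ n a =
      (GroupDistribution.comap (restrictUnits ((invAmice₁ 2 ((PowerSeries.subst (compSeriesC h2 hσ₀ u hε)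
          ((tildeSer ((u : 𝒪[F]) * ((2 : ℕ) : 𝒪[F])) (LTCoeff.of F (u : 𝒪[F])) (η b).logDeriv).map
            ((intToUnrCoeff F).comp (LTCoeff.of F).symm.toRingHom))).map Θ) (hC b)).density
          (ProfiniteTower.padicInt_isUniform 2) (unitInv 𝕜) uniformContinuous_unitInv norm_unitInv_le))
          ψ ((ltTower (isUniformizer_unit_mul h2 u)).cellMap_trans _ ψ hψ)
          ((ltTower (isUniformizer_unit_mul h2 u)).cellMap_injective _
            (mem_ltTower_iff (isUniformizer_unit_mul h2 u) e) ψ hψ)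
          ((ltTower (isUniformizer_unit_mul h2 u)).cellMap_fiberSurj _
            (mem_ltTower_iff (isUniformizer_unit_mul h2 u) e)
            (exists_toZModPow_ltCharacter_eq (isUniformizer_unit_mul h2 u) e) ψ hψ)).μ n a :=
  GroupDistribution.induce_μ_of_transLE_eq_one _ hC0 hCb
    (comap_μ_proj_mul_normCoherentUnits hq h2 hσ₀ u hε Θ e hΘe η hη hC ψ hψ) b n a
    (ltTower_transLE_zero_eq_one h2 u e n a)

end NormCoherentUnitFamilyTwo

end Literature.NumberTheory.EllipticCurves

end
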